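import Mathlib
import Summits.PneNP.PneNP.Theses.OneSlice
import Summits.PneNP.PneNP.Theorems.OneSliceSliceTargetSplit
import Summits.PneNP.PneNP.Theorems.OneSliceMonotoneContinuationDefs
import Summits.PneNP.PneNP.Theorems.OneSliceMonotoneContinuationTowerDown
import Summits.PneNP.PneNP.Theorems.OneSliceMonotoneContinuationLevelAverage

/-!
# Route OneSlice, crux `MonotoneContinuation` (stmt-PneNP-18471), line `Sketch_ideator1_r1` (ProfileLine) — sub-goal `nearBoolean_mono_above`

NEAR-BOOLEANNESS OF THE TRANSPORT PROPAGATES TOWARD THE SLICE FROM ABOVE. Write `ĝ = T_j 𝟙[f]`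
(`transport j (ind f)`) for the slice-`j` transport of the indicator of `f`. For `j ≤ r ≤ s ≤ N = C(n,2)` the
level-uniform mean of `ĝ(1 - ĝ) = ĝ - ĝ²` on the Hamming slice `r` is at most the one on the slice `s`.
Proof (tower + Jensen): the level means of `ĝ` on the slices `r` and `s` coincide — both equal the slice-`j`
mean of `𝟙[f]` (`stub_levelAverage`) — so it suffices that the level mean of `ĝ²` DECREASES from `r` to `s`.
By the downward tower property (`transport_tower_down`) `ĝ(y)` is, for `y ∈ slice s`, the average of `ĝ` over
the `r`-subsets `nbhd r y` of `supp y`, whence `ĝ(y)² ≤ T_r(ĝ²)(y)` (Cauchy–Schwarz,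
`sq_sum_le_card_mul_sum_sq`); summing over `slice s` and using the flat level averages of the slice-`r`
transport (`stub_levelAverage` again, now for `ĝ²`) gives `Σ_{slice s} ĝ² ≤ #slice_s · (Σ_{slice r} ĝ²)/#slice_r`.
-/

set_option linter.dupNamespace false -- `Summit.PneNP.PneNP.…`: summit = sub-problem (D-0017)

namespace Summit.PneNP.PneNP.Theorems.MonotoneContinuation

open Literature.Computability.Complexity hiding supp mem_supp
open Finset hiding slice
open Classical
open Summit.PneNP.PneNP.Theorems (card_slice)
open Summit.PneNP.PneNP.Theorems.ConstantBand.Negative (Edge slice)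
open Summit.PneNP.PneNP.Theorems.SliceTargetSplit (nbhd mem_nbhd transport ind card_nbhd_of_le)

noncomputable section

variable {n : ℕ}

/-- **Jensen through the tower**: for `j ≤ r ≤ e(y)` the square of the slice-`j` transport at `y` is at most the
slice-`r` transport at `y` of the square of the slice-`j` transport (`T_j g y` is the average of `T_j g` over the
nonempty `nbhd r y`, `transport_tower_down`). [folklore] -/
theorem nearBoolean_sq_transport_le {j r : ℕ} (g : (Edge n → Bool) → ℝ) {y : Edge n → Bool} (hjr : j ≤ r)
    (hry : r ≤ edgeCount y) :
    transport j g y ^ 2 ≤ transport r (fun u => transport j g u ^ 2) y := by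
  rw [transport_tower_down n j r g y hjr hry, transport]
  exact sum_div_card_sq_le_sum_sq_div_card

/-- **Level means of the squared transport decrease upward**: for `j ≤ r ≤ s ≤ C(n,2)` the level-uniform mean
of `(T_j g)²` on the slice `s` is at most the one on the slice `r` (pointwise Jensen through the tower, summed
over `slice s`, plus the flat level averages of the slice-`r` transport, `stub_levelAverage`). [folklore] -/
theorem nearBoolean_sum_sq_div_le {j r s : ℕ} (g : (Edge n → Bool) → ℝ) (hjr : j ≤ r) (hrs : r ≤ s)
    (hs : s ≤ n.choose 2) :
    (∑ y ∈ slice n s, transport j g y ^ 2) / #(slice n s) ≤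
      (∑ u ∈ slice n r, transport j g u ^ 2) / #(slice n r) := by
  have hpos : (0 : ℝ) < #(slice n s) := by rw [card_slice]; exact_mod_cast Nat.choose_pos hs
  rw [div_le_iff₀ hpos]
  calc ∑ y ∈ slice n s, transport j g y ^ 2
      ≤ ∑ y ∈ slice n s, transport r (fun u => transport j g u ^ 2) y :=
        sum_le_sum fun y hy => nearBoolean_sq_transport_le g hjr (by rw [(mem_filter.1 hy).2]; exact hrs)
    _ = (#(slice n s) : ℝ) * ((∑ u ∈ slice n r, transport j g u ^ 2) / #(slice n r)) :=
        stub_levelAverage n s r _ hs (hrs.trans hs)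
    _ = (∑ u ∈ slice n r, transport j g u ^ 2) / #(slice n r) * #(slice n s) := mul_comm _ _

/-- Splitting the level sum of `ĝ(1 - ĝ)` into the level sum of `ĝ` minus the level sum of `ĝ²`. [folklore] -/
private theorem nearBoolean_sum_mul_one_sub (t : Finset (Edge n → Bool)) (G : (Edge n → Bool) → ℝ) :
    ∑ u ∈ t, G u * (1 - G u) = ∑ u ∈ t, G u - ∑ u ∈ t, G u ^ 2 := by
  rw [← sum_sub_distrib]
  exact sum_congr rfl fun u _ => by ring

/-- **Near-Booleanness propagates toward the slice from above** (sub-goal `nearBoolean_mono_above` of the line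
`Sketch_ideator1_r1`; tower + Jensen): for `j ≤ r ≤ s ≤ C(n,2)` the level-uniform mean of `ĝ(1 − ĝ)`,
`ĝ = T_j 𝟙[f]`, is smaller on level `r` than on level `s` — the level means of `ĝ` agree (`stub_levelAverage`)
while the level mean of `ĝ²` decreases from `r` to `s` (`nearBoolean_sum_sq_div_le`). [folklore] -/
theorem nearBoolean_mono_above :
  ∀ (n j r s : ℕ) (f : (Edge n → Bool) → Bool), j ≤ r → r ≤ s → s ≤ n.choose 2 →
    (∑ u ∈ slice n r, transport j (ind f) u * (1 - transport j (ind f) u)) / #(slice n r) ≤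
      (∑ y ∈ slice n s, transport j (ind f) y * (1 - transport j (ind f) y)) / #(slice n s) := by
  intro n j r s f hjr hrs hs
  have hr : r ≤ n.choose 2 := hrs.trans hs
  have hj : j ≤ n.choose 2 := hjr.trans hr
  have hr0 : (0 : ℝ) < #(slice n r) := by rw [card_slice]; exact_mod_cast Nat.choose_pos hr
  have hs0 : (0 : ℝ) < #(slice n s) := by rw [card_slice]; exact_mod_cast Nat.choose_pos hs
  have key := nearBoolean_sum_sq_div_le (ind f) hjr hrs hs
  rw [nearBoolean_sum_mul_one_sub, nearBoolean_sum_mul_one_sub, stub_levelAverage n r j (ind f) hr hj,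
    stub_levelAverage n s j (ind f) hs hj, sub_div, sub_div, mul_div_cancel_left₀ _ hr0.ne',
    mul_div_cancel_left₀ _ hs0.ne']
  exact sub_le_sub_left key _

end

end Summit.PneNP.PneNP.Theorems.MonotoneContinuation
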